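import Summits.CriticalPhenomena.PercolationContinuityZ3.Theorems.PercNearOneGluingNoHeavyLowerTailNineTypeTwins
import Summits.CriticalPhenomena.PercolationContinuityZ3.Theorems.PercNearOneGluingNoHeavyLowerTailNineTypeRectangle

/-!
# Nine-type programme for `Q44b`: the FORK and DUAL-FORK lemmas (two more circuit classes of conjecture K1)

Support file for crux `stmt-CriticalPhenomena-4575` (master-family programme, quadratic four-point row `Q44b`,
GF(2)-rank line), seat `prim-bnk-1` gen 18; memo `run/shared/lean/prim/prim-l12/FROM-prim-bnk-1-gen18-KLEITMAN-SPLIT.md` §9.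

Setting as in `…NineTypeTwins` / `…NineTypeRectangle` (up-set `𝔊`, typed configuration `𝒯`, tables `hlOK`,
`contPairs`, COV, HL-forced goods, HH-forced goods `q ∪ f'` for `q` of type `8/9` and `f'` of type `5/7`).
Two four-element H-circuit shapes have the relation  `X ⊆ g ↔ (Y ⊆ g ∧ (j₁ ∈ g ↔ j₂ ∈ g))`  on all goods `g`
(`Y, Y+j₁, Y+j₂ ∈ 𝒯`, `j₁ ≠ j₂ ∉ Y`; it is the GF(2) relation `[X⊆g] = [Y⊆g]+[Y+j₁⊆g]+[Y+j₂⊆g]`):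
* the **dual fork** `{t, b, b+j₁, b+j₂}` (`X = t` free, `Y = b` and `b+j₁, b+j₂` anchored of type `8/9`): then no point
  contains `(t ∪ b)ᶜ` (`dualFork_no_cover`), so the filter certificate with `U = t ∪ b` shows that the L-row of `t` is not
  a GF(2)-combination of H-rows (`dualFork_L_row_not_H_combination`);
* the **fork** `{p, p+j₁, p+j₂, a}` (`X = a` of type `8/9`, `Y = p` free, tops `p+j₁`, `p+j₂` free): such a circuit excludes
  every point of type `1,2,3,4,6` from the configuration (`fork_no_low_type`), no point contains `((p+j₁) ∪ a)ᶜ`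
  (`fork_no_cover`), and the filter certificate with `U = (p+j₁) ∪ a` gives `fork_L_row_not_H_combination`.
INT m=5 census: twins 16 %, free rectangles 32 %, forks 20 %, dual forks 2 % of all H-circuit tops (memo §9).

Pure finite combinatorics; theorems only, no named facts, no sorries, standard axioms.
-/

namespace Summit.CriticalPhenomena.PercolationContinuityZ3.Theorems

namespace NineType

open Finset

/-- Table fact: types `8, 9` are HL-compatible with the anchored low types `1, 2, 3, 4, 6`. -/
theorem table_hl_anchor_low : ∀ a : ℕ, (a = 8 ∨ a = 9) → ∀ s : ℕ, 1 ≤ s → s ≤ 6 → s ≠ 5 → hlOK a s = true := by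
  intro a ha s hs1 hs6 hs5
  rcases ha with rfl | rfl <;> interval_cases s <;> first | decide | exact absurd rfl hs5

variable {α : Type*} [DecidableEq α] [Fintype α]

/-- **Dual-fork lemma, combinatorial core.**  Let `t ∈ 𝒯` be free, `b, b₁ = insert j₁ b, b₂ = insert j₂ b ∈ 𝒯` of type
`8/9` (`j₁ ≠ j₂`, `j₁, j₂ ∉ b`), and suppose the dual-fork relation `t ⊆ g ↔ (b ⊆ g ∧ (j₁ ∈ g ↔ j₂ ∈ g))` holds for every
good `g`.  Then no point `s ∈ 𝒯` contains `(t ∪ b)ᶜ`.  Proof: a type-`8/9` point `s` gives the good `s ∪ t ⊇ t`, hence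
`b ⊆ s ∪ t` and `s ∪ t = univ` (COV).  A type-`≤ 7` point gives the good `G₀ = s ∪ tᶜ`; evaluating the relation at
`G₀ ∪ b`, `G₀ ∪ b₁`, `G₀ ∪ b₂` according to whether `j₁, j₂ ∈ G₀` forces `s ∪ b = univ`, `s ∪ b₂ = univ`, `s ∪ b₁ = univ`
or `j₁ ∈ b` respectively — COV or absurd. [this work, memo §9] -/
theorem dualFork_no_cover (𝒯 : Finset (Finset α)) (θ : Finset α → ℕ)
    (hθ : ∀ s ∈ 𝒯, 1 ≤ θ s ∧ θ s ≤ 9)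
    (hcov : ∀ s ∈ 𝒯, ∀ s' ∈ 𝒯, s ≠ s' → s ∪ s' ≠ univ)
    (𝔊 : Finset (Finset α)) (hG : ∀ g ∈ 𝔊, ∀ g' : Finset α, g ⊆ g' → g' ∈ 𝔊)
    (hHL : ∀ s ∈ 𝒯, ∀ s' ∈ 𝒯, hlOK (θ s) (θ s') = true → s ∪ s'ᶜ ∈ 𝔊)
    (hHH : ∀ q ∈ 𝒯, ∀ f' ∈ 𝒯, (θ q = 8 ∨ θ q = 9) → (θ f' = 5 ∨ θ f' = 7) → q ∪ f' ∈ 𝔊)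
    (t : Finset α) (ht : t ∈ 𝒯) (ht57 : θ t = 5 ∨ θ t = 7)
    (b : Finset α) (hb : b ∈ 𝒯) (hb89 : θ b = 8 ∨ θ b = 9)
    (j₁ j₂ : α) (hj₁ : j₁ ∉ b) (hj₂ : j₂ ∉ b)
    (b₁ : Finset α) (hb₁ : b₁ ∈ 𝒯) (hb₁e : b₁ = insert j₁ b) (hb₁89 : θ b₁ = 8 ∨ θ b₁ = 9)
    (b₂ : Finset α) (hb₂ : b₂ ∈ 𝒯) (hb₂e : b₂ = insert j₂ b) (hb₂89 : θ b₂ = 8 ∨ θ b₂ = 9)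
    (hrel : ∀ g ∈ 𝔊, t ⊆ g ↔ (b ⊆ g ∧ (j₁ ∈ g ↔ j₂ ∈ g))) :
    ∀ s ∈ 𝒯, ¬ (t ∪ b)ᶜ ⊆ s := by
  intro s hs hK
  -- points of different type classes are different
  have hne : ∀ u ∈ 𝒯, (θ u = 8 ∨ θ u = 9) → ∀ v ∈ 𝒯, (θ v = 5 ∨ θ v = 7) → u ≠ v := by
    intro u _ hu v _ hv h; rw [h] at hu; rcases hu with h8 | h9 <;> rcases hv with h5 | h7 <;> omega
  by_cases hs89 : θ s = 8 ∨ θ s = 9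
  · -- `s ∪ t` is a good containing `t`, hence `b`; so `s ∪ t = univ`
    have hgood : s ∪ t ∈ 𝔊 := hHH s hs t ht hs89 ht57
    have hb' : b ⊆ s ∪ t := ((hrel _ hgood).1 subset_union_right).1
    exact hcov s hs t ht (hne s hs hs89 t ht ht57)
      (union_eq_univ_of_compl_subset t b s t hK subset_union_right hb')
  · have hs7 : θ s ≤ 7 := by rcases hθ s hs with ⟨_, h9⟩; omega
    have hsb : ∀ u ∈ 𝒯, (θ u = 8 ∨ θ u = 9) → s ≠ u := by
      intro u _ hu h; rw [← h] at hu; exact hs89 hu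
    have hG₀ : s ∪ tᶜ ∈ 𝔊 := hHL s hs t ht (table_hl_low_free (θ s) (hθ s hs).1 hs7 (θ t) ht57)
    -- for a good `(s ∪ tᶜ) ∪ u` with `b ⊆ u` and `j₁, j₂` alike, the relation gives `t ⊆ s ∪ u`
    have key : ∀ u : Finset α, b ⊆ u → ((j₁ ∈ s ∪ tᶜ ∪ u) ↔ (j₂ ∈ s ∪ tᶜ ∪ u)) → t ⊆ s ∪ u := by
      intro u hbu hiff
      have hg : s ∪ tᶜ ∪ u ∈ 𝔊 := hG _ hG₀ _ subset_union_left
      have htg : t ⊆ s ∪ tᶜ ∪ u := (hrel _ hg).2 ⟨hbu.trans subset_union_right, hiff⟩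
      intro x hx
      rcases Finset.mem_union.1 (htg hx) with h | h
      · rcases Finset.mem_union.1 h with h | h
        · exact Finset.mem_union.2 (Or.inl h)
        · exact absurd hx (Finset.mem_compl.1 h)
      · exact Finset.mem_union.2 (Or.inr h)
    have memj : ∀ (j : α) (u : Finset α), j ∈ s ∪ tᶜ ∪ u ↔ (j ∈ s ∨ j ∉ t) ∨ j ∈ u := by
      intro j u
      rw [Finset.mem_union, Finset.mem_union, Finset.mem_compl]
    have hbb₁ : b ⊆ b₁ := by rw [hb₁e]; exact Finset.subset_insert j₁ b
    have hbb₂ : b ⊆ b₂ := by rw [hb₂e]; exact Finset.subset_insert j₂ b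
    have hj₁b₁ : j₁ ∈ b₁ := by rw [hb₁e]; exact Finset.mem_insert_self j₁ b
    have hj₂b₂ : j₂ ∈ b₂ := by rw [hb₂e]; exact Finset.mem_insert_self j₂ b
    by_cases P₁ : j₁ ∈ s ∨ j₁ ∉ t <;> by_cases P₂ : j₂ ∈ s ∨ j₂ ∉ t
    · -- both: use `u = b`
      have htb : t ⊆ s ∪ b := key b (subset_refl _) (by
        rw [memj, memj]; exact ⟨fun _ => Or.inl P₂, fun _ => Or.inl P₁⟩)
      exact hcov s hs b hb (hsb b hb hb89)
        (union_eq_univ_of_compl_subset t b s b hK htb subset_union_right)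
    · -- `P₁`, not `P₂`: use `u = b₂ ∋ j₂`
      have htb : t ⊆ s ∪ b₂ := key b₂ hbb₂ (by
        rw [memj, memj]
        exact ⟨fun _ => Or.inr hj₂b₂, fun _ => Or.inl P₁⟩)
      exact hcov s hs b₂ hb₂ (hsb b₂ hb₂ hb₂89)
        (union_eq_univ_of_compl_subset t b s b₂ hK htb (hbb₂.trans subset_union_right))
    · -- not `P₁`, `P₂`: use `u = b₁ ∋ j₁`
      have htb : t ⊆ s ∪ b₁ := key b₁ hbb₁ (by
        rw [memj, memj]
        exact ⟨fun _ => Or.inl P₂, fun _ => Or.inr hj₁b₁⟩)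
      exact hcov s hs b₁ hb₁ (hsb b₁ hb₁ hb₁89)
        (union_eq_univ_of_compl_subset t b s b₁ hK htb (hbb₁.trans subset_union_right))
    · -- neither: `u = b` again; then `j₁ ∈ t ⊆ s ∪ b` is absurd
      have htb : t ⊆ s ∪ b := key b (subset_refl _) (by
        rw [memj, memj]
        constructor
        · rintro (h | h)
          · exact absurd h P₁
          · exact absurd h hj₁
        · rintro (h | h)
          · exact absurd h P₂
          · exact absurd h hj₂)
      have hj₁t : j₁ ∈ t := by
        by_contra h
        exact P₁ (Or.inr h)
      rcases Finset.mem_union.1 (htb hj₁t) with h | h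
      · exact P₁ (Or.inl h)
      · exact hj₁ h

/-- **Dual-fork lemma** (memo §9): under the hypotheses of `dualFork_no_cover`, the L-row of `t` is not a
GF(2)-combination of H-rows (filter certificate with the HH-good `U = t ∪ b`). [this work] -/
theorem dualFork_L_row_not_H_combination (𝒯 : Finset (Finset α)) (θ : Finset α → ℕ)
    (hθ : ∀ s ∈ 𝒯, 1 ≤ θ s ∧ θ s ≤ 9)
    (hcov : ∀ s ∈ 𝒯, ∀ s' ∈ 𝒯, s ≠ s' → s ∪ s' ≠ univ)
    (𝔊 : Finset (Finset α)) (hG : ∀ g ∈ 𝔊, ∀ g' : Finset α, g ⊆ g' → g' ∈ 𝔊)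
    (hHL : ∀ s ∈ 𝒯, ∀ s' ∈ 𝒯, hlOK (θ s) (θ s') = true → s ∪ s'ᶜ ∈ 𝔊)
    (hHH : ∀ q ∈ 𝒯, ∀ f' ∈ 𝒯, (θ q = 8 ∨ θ q = 9) → (θ f' = 5 ∨ θ f' = 7) → q ∪ f' ∈ 𝔊)
    (t : Finset α) (ht : t ∈ 𝒯) (ht57 : θ t = 5 ∨ θ t = 7)
    (b : Finset α) (hb : b ∈ 𝒯) (hb89 : θ b = 8 ∨ θ b = 9)
    (j₁ j₂ : α) (hj₁ : j₁ ∉ b) (hj₂ : j₂ ∉ b)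
    (b₁ : Finset α) (hb₁ : b₁ ∈ 𝒯) (hb₁e : b₁ = insert j₁ b) (hb₁89 : θ b₁ = 8 ∨ θ b₁ = 9)
    (b₂ : Finset α) (hb₂ : b₂ ∈ 𝒯) (hb₂e : b₂ = insert j₂ b) (hb₂89 : θ b₂ = 8 ∨ θ b₂ = 9)
    (hrel : ∀ g ∈ 𝔊, t ⊆ g ↔ (b ⊆ g ∧ (j₁ ∈ g ↔ j₂ ∈ g)))
    (S : Finset (Finset α)) (hS : S ⊆ 𝒯) :
    ¬ (∀ g ∈ 𝔊, ((#(S.filter (fun s => s ⊆ g)) : ℕ) : ZMod 2) = if tᶜ ⊆ g then 1 else 0) := by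
  have hU : t ∪ b ∈ 𝔊 := by rw [Finset.union_comm]; exact hHH b hb t ht hb89 ht57
  exact filter_certificate 𝔊 hG (t ∪ b) hU t subset_union_left S
    (fun s hs => dualFork_no_cover 𝒯 θ hθ hcov 𝔊 hG hHL hHH t ht ht57 b hb hb89 j₁ j₂ hj₁ hj₂
      b₁ hb₁ hb₁e hb₁89 b₂ hb₂ hb₂e hb₂89 hrel s (hS hs))

/-- **A fork circuit excludes the anchored low types.**  Let `p ∈ 𝒯` be free and `a ∈ 𝒯` of type `8/9` with the fork
relation `a ⊆ g ↔ (p ⊆ g ∧ (j₁ ∈ g ↔ j₂ ∈ g))` on all goods, where `p₁ = insert j₁ p ∈ 𝒯` is free.  Then `𝒯` has no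
point of type `1,2,3,4,6`: such an `s` gives the goods `a ∪ sᶜ` (so `p ∩ s ⊆ a`) and `s ∪ p₁ᶜ ∪ a ⊇ a` (so `p ⊆ s ∪ a`),
whence `p ⊆ a`, excluded by `contPairs`. [this work, memo §9] -/
theorem fork_no_low_type (𝒯 : Finset (Finset α)) (θ : Finset α → ℕ)
    (hθ : ∀ s ∈ 𝒯, 1 ≤ θ s ∧ θ s ≤ 9)
    (hcont : ∀ s ∈ 𝒯, ∀ s' ∈ 𝒯, s ⊆ s' → (θ s, θ s') ∈ contPairs)
    (𝔊 : Finset (Finset α)) (hG : ∀ g ∈ 𝔊, ∀ g' : Finset α, g ⊆ g' → g' ∈ 𝔊)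
    (hHL : ∀ s ∈ 𝒯, ∀ s' ∈ 𝒯, hlOK (θ s) (θ s') = true → s ∪ s'ᶜ ∈ 𝔊)
    (p : Finset α) (hp : p ∈ 𝒯) (hp57 : θ p = 5 ∨ θ p = 7)
    (a : Finset α) (ha : a ∈ 𝒯) (ha89 : θ a = 8 ∨ θ a = 9)
    (j₁ j₂ : α)
    (p₁ : Finset α) (hp₁ : p₁ ∈ 𝒯) (hp₁e : p₁ = insert j₁ p) (hp₁57 : θ p₁ = 5 ∨ θ p₁ = 7)
    (hrel : ∀ g ∈ 𝔊, a ⊆ g ↔ (p ⊆ g ∧ (j₁ ∈ g ↔ j₂ ∈ g))) :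
    ∀ s ∈ 𝒯, ¬ (θ s ≤ 6 ∧ θ s ≠ 5) := by
  rintro s hs ⟨hs6, hs5⟩
  have hg1 : a ∪ sᶜ ∈ 𝔊 := hHL a ha s hs (table_hl_anchor_low (θ a) ha89 (θ s) (hθ s hs).1 hs6 hs5)
  have hg2 : s ∪ p₁ᶜ ∈ 𝔊 := hHL s hs p₁ hp₁ (table_hl_low_free (θ s) (hθ s hs).1 (by omega) (θ p₁) hp₁57)
  have h1 : p ⊆ a ∪ sᶜ := ((hrel _ hg1).1 subset_union_left).1
  have hg3 : s ∪ p₁ᶜ ∪ a ∈ 𝔊 := hG _ hg2 _ subset_union_left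
  have h2 : p ⊆ s ∪ p₁ᶜ ∪ a := ((hrel _ hg3).1 subset_union_right).1
  have hpa : p ⊆ a := by
    intro x hx
    by_contra hxa
    have hxs : x ∉ s := by
      rcases Finset.mem_union.1 (h1 hx) with h | h
      · exact absurd h hxa
      · exact Finset.mem_compl.1 h
    rcases Finset.mem_union.1 (h2 hx) with h | h
    · rcases Finset.mem_union.1 h with h | h
      · exact hxs h
      · exact (Finset.mem_compl.1 h) (by rw [hp₁e]; exact Finset.mem_insert_of_mem hx)
    · exact hxa h
  exact (table_twins_pair (θ p) hp57 (θ a) ha89).2 (hcont p hp a ha hpa)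

/-- **Fork lemma, combinatorial core.**  Let `p, p₁ = insert j₁ p, p₂ = insert j₂ p ∈ 𝒯` be free (`j₁ ≠ j₂ ∉ p`) and
`a ∈ 𝒯` of type `8/9` with the fork relation `a ⊆ g ↔ (p ⊆ g ∧ (j₁ ∈ g ↔ j₂ ∈ g))` on all goods.  Then no point
`s ∈ 𝒯` contains `(p₁ ∪ a)ᶜ`.  Proof: by `fork_no_low_type` the point `s` is free or of type `8/9`.  Free: the good
`s ∪ a ⊇ a` contains `p` and has `j₁ ∈ · ↔ j₂ ∈ ·`, and covers everything except possibly `j₁`, so it is `univ` (COV).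
Type `8/9`: the goods `s ∪ p₁`, `s ∪ p₂`, `s ∪ p` force `j₂ ∉ s`, `j₁ ∉ s` (else `s ∪ p₁` or `s ∪ p₂ = univ`) and then
`a ⊆ s ∪ p`, i.e. `j₂ ∈ s ∪ p` although `j₂ ∈ a ∖ (s ∪ p)` — absurd. [this work, memo §9] -/
theorem fork_no_cover (𝒯 : Finset (Finset α)) (θ : Finset α → ℕ)
    (hθ : ∀ s ∈ 𝒯, 1 ≤ θ s ∧ θ s ≤ 9)
    (hcont : ∀ s ∈ 𝒯, ∀ s' ∈ 𝒯, s ⊆ s' → (θ s, θ s') ∈ contPairs)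
    (hcov : ∀ s ∈ 𝒯, ∀ s' ∈ 𝒯, s ≠ s' → s ∪ s' ≠ univ)
    (𝔊 : Finset (Finset α)) (hG : ∀ g ∈ 𝔊, ∀ g' : Finset α, g ⊆ g' → g' ∈ 𝔊)
    (hHL : ∀ s ∈ 𝒯, ∀ s' ∈ 𝒯, hlOK (θ s) (θ s') = true → s ∪ s'ᶜ ∈ 𝔊)
    (hHH : ∀ q ∈ 𝒯, ∀ f' ∈ 𝒯, (θ q = 8 ∨ θ q = 9) → (θ f' = 5 ∨ θ f' = 7) → q ∪ f' ∈ 𝔊)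
    (p : Finset α) (hp : p ∈ 𝒯) (hp57 : θ p = 5 ∨ θ p = 7)
    (a : Finset α) (ha : a ∈ 𝒯) (ha89 : θ a = 8 ∨ θ a = 9)
    (j₁ j₂ : α) (hj : j₁ ≠ j₂) (hj₁ : j₁ ∉ p) (hj₂ : j₂ ∉ p)
    (p₁ : Finset α) (hp₁ : p₁ ∈ 𝒯) (hp₁e : p₁ = insert j₁ p) (hp₁57 : θ p₁ = 5 ∨ θ p₁ = 7)
    (p₂ : Finset α) (hp₂ : p₂ ∈ 𝒯) (hp₂e : p₂ = insert j₂ p) (hp₂57 : θ p₂ = 5 ∨ θ p₂ = 7)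
    (hrel : ∀ g ∈ 𝔊, a ⊆ g ↔ (p ⊆ g ∧ (j₁ ∈ g ↔ j₂ ∈ g))) :
    ∀ s ∈ 𝒯, ¬ (p₁ ∪ a)ᶜ ⊆ s := by
  intro s hs hK
  have hne : ∀ u ∈ 𝒯, (θ u = 8 ∨ θ u = 9) → ∀ v ∈ 𝒯, (θ v = 5 ∨ θ v = 7) → u ≠ v := by
    intro u _ hu v _ hv h; rw [h] at hu; rcases hu with h8 | h9 <;> rcases hv with h5 | h7 <;> omega
  -- every element outside `p₁ ∪ a` lies in `s`
  have hout : ∀ x, x ∉ p → x ≠ j₁ → x ∉ a → x ∈ s := by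
    intro x hxp hxj hxa
    apply hK
    rw [Finset.mem_compl, Finset.mem_union, hp₁e, Finset.mem_insert, not_or, not_or]
    exact ⟨⟨hxj, hxp⟩, hxa⟩
  have hlow := fork_no_low_type 𝒯 θ hθ hcont 𝔊 hG hHL p hp hp57 a ha ha89 j₁ j₂ p₁ hp₁ hp₁e hp₁57 hrel s hs
  by_cases hs89 : θ s = 8 ∨ θ s = 9
  · have hgp : s ∪ p ∈ 𝔊 := hHH s hs p hp hs89 hp57
    have hgp₁ : s ∪ p₁ ∈ 𝔊 := hHH s hs p₁ hp₁ hs89 hp₁57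
    have hgp₂ : s ∪ p₂ ∈ 𝔊 := hHH s hs p₂ hp₂ hs89 hp₂57
    -- covering step: `a ⊆ s ∪ q`, `p ⊆ q`, `j₁ ∈ s ∪ q` ⇒ `s ∪ q = univ`
    have cover : ∀ q ∈ 𝒯, (θ q = 5 ∨ θ q = 7) → p ⊆ q → j₁ ∈ s ∪ q → a ⊆ s ∪ q → False := by
      intro q hq hq57 hpq hj1 haq
      apply hcov s hs q hq (hne s hs hs89 q hq hq57)
      refine Finset.eq_univ_iff_forall.2 fun x => ?_
      by_cases hxp : x ∈ p
      · exact Finset.mem_union.2 (Or.inr (hpq hxp))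
      · by_cases hxj : x = j₁
        · rw [hxj]; exact hj1
        · by_cases hxa : x ∈ a
          · exact haq hxa
          · exact Finset.mem_union.2 (Or.inl (hout x hxp hxj hxa))
    have hpp₁ : p ⊆ p₁ := by rw [hp₁e]; exact Finset.subset_insert j₁ p
    have hpp₂ : p ⊆ p₂ := by rw [hp₂e]; exact Finset.subset_insert j₂ p
    have hj₁p₁ : j₁ ∈ s ∪ p₁ := Finset.mem_union.2 (Or.inr (by rw [hp₁e]; exact Finset.mem_insert_self j₁ p))
    have hj₂p₂ : j₂ ∈ s ∪ p₂ := Finset.mem_union.2 (Or.inr (by rw [hp₂e]; exact Finset.mem_insert_self j₂ p))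
    -- `j₂ ∉ s`
    have hj₂s : j₂ ∉ s := by
      intro h
      have hj₂p₁ : j₂ ∈ s ∪ p₁ := Finset.mem_union.2 (Or.inl h)
      have haq : a ⊆ s ∪ p₁ :=
        (hrel _ hgp₁).2 ⟨hpp₁.trans subset_union_right, ⟨fun _ => hj₂p₁, fun _ => hj₁p₁⟩⟩
      exact cover p₁ hp₁ hp₁57 hpp₁ hj₁p₁ haq
    -- hence `j₂ ∈ a`
    have hj₂a : j₂ ∈ a := by
      by_contra h
      exact hj₂s (hout j₂ hj₂ (Ne.symm hj) h)
    -- `j₁ ∉ s`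
    have hj₁s : j₁ ∉ s := by
      intro h
      have hj₁p₂ : j₁ ∈ s ∪ p₂ := Finset.mem_union.2 (Or.inl h)
      have haq : a ⊆ s ∪ p₂ :=
        (hrel _ hgp₂).2 ⟨hpp₂.trans subset_union_right, ⟨fun _ => hj₂p₂, fun _ => hj₁p₂⟩⟩
      exact cover p₂ hp₂ hp₂57 hpp₂ hj₁p₂ haq
    -- at `s ∪ p` neither `j₁` nor `j₂` is present, so `a ⊆ s ∪ p`; but `j₂ ∈ a`
    have hj₁sp : j₁ ∉ s ∪ p := fun h => by
      rcases Finset.mem_union.1 h with h | h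
      · exact hj₁s h
      · exact hj₁ h
    have hj₂sp : j₂ ∉ s ∪ p := fun h => by
      rcases Finset.mem_union.1 h with h | h
      · exact hj₂s h
      · exact hj₂ h
    have haq : a ⊆ s ∪ p :=
      (hrel _ hgp).2 ⟨subset_union_right, ⟨fun h => absurd h hj₁sp, fun h => absurd h hj₂sp⟩⟩
    exact hj₂sp (haq hj₂a)
  · -- `s` is free: the good `s ∪ a` would be `univ`
    have hs57 : θ s = 5 ∨ θ s = 7 := by
      rcases hθ s hs with ⟨h1, h9⟩
      by_contra h
      rw [not_or] at h
      apply hlow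
      constructor <;> omega
    have hg : s ∪ a ∈ 𝔊 := by rw [Finset.union_comm]; exact hHH a ha s hs ha89 hs57
    have hr := (hrel _ hg).1 subset_union_right
    have hsa : s ≠ a := fun h => hne a ha ha89 s hs hs57 h.symm
    have hj₁sa : j₁ ∈ s ∪ a := by
      by_contra h1
      have h2 : j₂ ∉ s ∪ a := fun h => h1 (hr.2.2 h)
      have hj₂a : j₂ ∉ a := fun h => h2 (Finset.mem_union.2 (Or.inr h))
      exact h2 (Finset.mem_union.2 (Or.inl (hout j₂ hj₂ (Ne.symm hj) hj₂a)))
    apply hcov s hs a ha hsa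
    refine Finset.eq_univ_iff_forall.2 fun x => ?_
    by_cases hxp : x ∈ p
    · exact hr.1 hxp
    · by_cases hxj : x = j₁
      · rw [hxj]; exact hj₁sa
      · by_cases hxa : x ∈ a
        · exact Finset.mem_union.2 (Or.inr hxa)
        · exact Finset.mem_union.2 (Or.inl (hout x hxp hxj hxa))

/-- **Fork lemma** (memo §9): under the hypotheses of `fork_no_cover`, the L-row of the top `p₁ = insert j₁ p` is not a
GF(2)-combination of H-rows (filter certificate with the HH-good `U = p₁ ∪ a`). [this work] -/
theorem fork_L_row_not_H_combination (𝒯 : Finset (Finset α)) (θ : Finset α → ℕ)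
    (hθ : ∀ s ∈ 𝒯, 1 ≤ θ s ∧ θ s ≤ 9)
    (hcont : ∀ s ∈ 𝒯, ∀ s' ∈ 𝒯, s ⊆ s' → (θ s, θ s') ∈ contPairs)
    (hcov : ∀ s ∈ 𝒯, ∀ s' ∈ 𝒯, s ≠ s' → s ∪ s' ≠ univ)
    (𝔊 : Finset (Finset α)) (hG : ∀ g ∈ 𝔊, ∀ g' : Finset α, g ⊆ g' → g' ∈ 𝔊)
    (hHL : ∀ s ∈ 𝒯, ∀ s' ∈ 𝒯, hlOK (θ s) (θ s') = true → s ∪ s'ᶜ ∈ 𝔊)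
    (hHH : ∀ q ∈ 𝒯, ∀ f' ∈ 𝒯, (θ q = 8 ∨ θ q = 9) → (θ f' = 5 ∨ θ f' = 7) → q ∪ f' ∈ 𝔊)
    (p : Finset α) (hp : p ∈ 𝒯) (hp57 : θ p = 5 ∨ θ p = 7)
    (a : Finset α) (ha : a ∈ 𝒯) (ha89 : θ a = 8 ∨ θ a = 9)
    (j₁ j₂ : α) (hj : j₁ ≠ j₂) (hj₁ : j₁ ∉ p) (hj₂ : j₂ ∉ p)
    (p₁ : Finset α) (hp₁ : p₁ ∈ 𝒯) (hp₁e : p₁ = insert j₁ p) (hp₁57 : θ p₁ = 5 ∨ θ p₁ = 7)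
    (p₂ : Finset α) (hp₂ : p₂ ∈ 𝒯) (hp₂e : p₂ = insert j₂ p) (hp₂57 : θ p₂ = 5 ∨ θ p₂ = 7)
    (hrel : ∀ g ∈ 𝔊, a ⊆ g ↔ (p ⊆ g ∧ (j₁ ∈ g ↔ j₂ ∈ g)))
    (S : Finset (Finset α)) (hS : S ⊆ 𝒯) :
    ¬ (∀ g ∈ 𝔊, ((#(S.filter (fun s => s ⊆ g)) : ℕ) : ZMod 2) = if p₁ᶜ ⊆ g then 1 else 0) := by
  have hU : p₁ ∪ a ∈ 𝔊 := by rw [Finset.union_comm]; exact hHH a ha p₁ hp₁ ha89 hp₁57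
  exact filter_certificate 𝔊 hG (p₁ ∪ a) hU p₁ subset_union_left S
    (fun s hs => fork_no_cover 𝒯 θ hθ hcont hcov 𝔊 hG hHL hHH p hp hp57 a ha ha89 j₁ j₂ hj hj₁ hj₂
      p₁ hp₁ hp₁e hp₁57 p₂ hp₂ hp₂e hp₂57 hrel s (hS hs))

end NineType

end Summit.CriticalPhenomena.PercolationContinuityZ3.Theorems
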